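import Summits.RiemannHypothesis.RiemannHypothesis.Theorems.WeilTwoPrimeDeflE25EBase
import Summits.RiemannHypothesis.RiemannHypothesis.Theorems.WeilTwoPrimeDeflE25EDataPE33
import Summits.RiemannHypothesis.RiemannHypothesis.Theorems.WeilTwoPrimeDeflE25EDataDnE18
import Literature.NumberTheory.LFunctions.WeilBlockRowsPZ
import Literature.NumberTheory.LFunctions.WeilBlockRowsFast
import HarnessLib

/-!
# Even-sector deflated two-prime certificate E25E: dominance of row 38 of `R = S''_even(κ') − UᵀU` (factored data)

`WeilCert.checkDomRowF` (linear-traversal form) with the materialized augmented block, the factored inverse `weilCertDeflE25EDnE/weilCertDeflE25ELsE` and the Bessel block, by `decide +kernel`, then `WeilCert.checkDomRowPZ_of_F`. Pure proof file.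
-/

set_option linter.dupNamespace false

noncomputable section

namespace Summit.RiemannHypothesis.RiemannHypothesis.Theorems.EvenWinsBeyondArch

open Literature.NumberTheory.LFunctions

set_option maxHeartbeats 0 in
/-- Kernel check of the dominance of row 38 of `R` (even block, certificate E25E). [folklore] -/
theorem checkDomRowF0_38_weilCertDeflE25E :
    weilCertDeflE25EBase.checkDomRowF weilCertDeflE25EPmE weilCertDeflE25EDnE weilCertDeflE25ELsE weilCertDeflE25EHpE weilCertDeflE25EKappa' 0 38 = true := by
  decide +kernel

/-- Kernel check of the dominance of row 38 of `R` (factored data), from the fast row. [folklore] -/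
theorem checkDomRowPZ0_38_weilCertDeflE25E :
    weilCertDeflE25EBase.checkDomRowPZ weilCertDeflE25EPmE weilCertDeflE25EDnE weilCertDeflE25ELsE weilCertDeflE25EHpE weilCertDeflE25EKappa' 0 38 = true :=
  WeilCert.checkDomRowPZ_of_F (by decide) checkDomRowF0_38_weilCertDeflE25E


end Summit.RiemannHypothesis.RiemannHypothesis.Theorems.EvenWinsBeyondArch
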